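import Summits.BirchSwinnertonDyer.BirchSwinnertonDyer.Theorems.ByReductionTypeAtTwoMultTowerSplitTowerAlgebra
import Summits.BirchSwinnertonDyer.BirchSwinnertonDyer.Theorems.ByReductionTypeAtTwoMultTowerNS2TateTransport
import Summits.BirchSwinnertonDyer.BirchSwinnertonDyer.Theorems.ByReductionTypeAtTwoMultTowerNS2TorsionEmbedding
import Literature.NumberTheory.EllipticCurves.Greenberg1999.ControlLocalKernelAtPMultiplicative
import Literature.NumberTheory.EllipticCurves.TateCurve.NumberFieldUniformization
import Literature.NumberTheory.EllipticCurves.PAdicBSDSplitMultiplicativeProofs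
import Literature.NumberTheory.EllipticCurves.SelmerCorankControlRatProofs
import HarnessLib

/-!
# Route `ByReductionTypeAtTwo`, crux `MultUpperHalfAtTwo` (item stmt-BirchSwinnertonDyer-19922), TOWER road, the
# «ONE BIT AT A SPLIT MULTIPLICATIVE PRIME» rows: KERNEL PROOF of the PRINT binder `hSP1`
# (`Greenberg1999.sec3_natCard_pTorsion_localTowerKerPrimary_le_splitMultiplicative_rat`, Greenberg LNM 1716 §3 pp. 91–92)

HONEST FRAMING (cell `bsd-2adic`, run/shared/lean/pub/bsd-2adic/, seat `bsd-2adic-tower-1` GEN 10, HUMAN RULINGS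
D-0036 / D-0054 / D-0074): theorems only (no definition, no named fact, no `sorry`); this file PROVES the displayed
PRINT binder `hSP1` of the split one-bit tower doors (`…MultUpperHalfTowerSplitOneBit.lean`, seat bsd-2adic-mult GEN 12;
cell memo HOME/mult/NOTE-SP1ONE.md, whose §5 is the road taken here) as a kernel theorem, for EVERY prime `p` as the
named fact is stated; it closes no item by itself (the binder is a HYPOTHESIS of split tower class files of item 19922,
whose other hypotheses stay displayed); nothing booked; BSD is not proved by any of this.

THE PROOF (Greenberg, LNM 1716, §3, pp. 91–92 "`ker(r_{v_n}) ⊆ ker(d_{v_n}) ≅ ℚ_p/ℤ_p`", made explicit on the Tate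
module). For `W/ℚ` globally minimal, SPLIT multiplicative at `p`, `κ` cyclotomic, `v ∋ p`, `n`:
* BRICK 11 (`MultTowerNS2.finite_torsionBy_localTowerKerPrimary_and_card_le`): `𝒦_{v,n}[p^∞][p] ↪ (M_∞/(g−1)M_∞)[p]`,
  `M_∞ = E(K̄_v)^{H_∞}`, `g ∈ H_n` a topological generator of `H_n` mod `H_∞` (`κ(res g) = p^n·unit`,
  `MultTowerSP1.exists_units_kappa_resGal_eq_of_generate`);
* Tate's SPLIT uniformisation `Φ : K̄_vˣ → E(K̄_v)` (`TateCurve.Silverman1994_thmV53_tateUniformisation_holds`, a tree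
  THEOREM: onto, kernel `q^ℤ`, `Γ_{ℚ_v}`-equivariant) identifies `M_∞` with `Φ(L_∞ˣ)`, `L_∞ = K̄_v^{H_∞}`
  (`exists_unit_of_mem_fixedPoints`: a preimage of an `H_∞`-fixed point is `H_∞`-fixed, by the orbit-finiteness lemma
  `MultTowerNS2.smul_eq_self_of_smul_eq_zpow_mul`), so a `p`-torsion class is `[Φ x]` with `x^p = q^j · gz/z`, `x, z ∈ L_∞ˣ`;
* two classes with `j ≡ j' (mod p)` coincide: `y = (x/x')q^c` (`pc = j' − j`) has `y^p = gζ/ζ` (`ζ = z/z'`), hence at a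
  finite level `F_{n+R} ∋ y, ζ` (`MultTowerSP1.exists_forall_mem_localSubgroup_layerSubgroup_smul_eq`) the orbit product
  `N_R(y) = ∏_{i<p^R} g^i y` has `N_R(y)^p = N_R(gζ)/N_R(ζ) = 1` and so `N_{R+1}(y) = N_R(y)^p = 1`; by the cyclic
  Hilbert 90 one layer up (`MultTowerSP1.exists_eq_smul_div_of_prod_smul_eq_one`) `y = gw/w` with `w ∈ F_{n+R+1}ˣ ⊆ L_∞ˣ`,
  i.e. `Φ(x) − Φ(x') = (g − 1)Φ(w) ∈ (g − 1)M_∞`;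
* pigeonhole: among any `p + 1` classes of `(M_∞/(g−1)M_∞)[p]` two coincide, so that `p`-torsion is finite of order `≤ p`,
  and so is `𝒦_{v,n}[p^∞][p]`.

* `exists_unit_of_mem_fixedPoints` — `E(K̄_v)^N ⊆ Φ((K̄_v^N)ˣ)` for any subgroup `N ≤ Γ_{ℚ_v}` (split transport);
* `sec3_natCard_pTorsion_localTowerKerPrimary_le_splitMultiplicative_rat_holds` — the binder, proved (type = the Literature
  `Prop` verbatim).

References: R. Greenberg, LNM 1716 (1999), §3 pp. 85–93 (esp. pp. 91–92); J. Silverman, GTM 151, Thm. V.3.1, Thm. V.5.3;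
J. Neukirch, *ANT* IV (3.5) (Hilbert 90); cell memo NOTE-SP1ONE.md §5.
-/

set_option autoImplicit false
-- the Theorems namespace of this sub repeats the summit name by design (D-0017 nested layout: Summit.<S>.<Sub>)
set_option linter.dupNamespace false

noncomputable section

open scoped Classical

namespace Summit.BirchSwinnertonDyer.BirchSwinnertonDyer.Theorems.MultTowerSP1

open NumberField IsDedekindDomain Field WeierstrassCurve PadicInt Rat.HeightOneSpectrum
  Literature.NumberTheory.EllipticCurves Literature.NumberTheory.EllipticCurves.ResKernel
  Literature.NumberTheory.GaloisRepresentations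

/-! ### Transport along the SPLIT Tate uniformisation: `E(K̄_v)^N = Φ((K̄_v^N)ˣ)` -/

/-- **`E(K̄_v)^N ⊆ Φ((K̄_v^N)ˣ)`** for the split (honestly `Γ`-equivariant) Tate uniformisation `Φ` with kernel `q^ℤ`
and any subgroup `N ≤ Γ_{ℚ_v}`: a point fixed by `N` is `Φ(x)` with `x` fixed by `N`. For `h ∈ N`:
`Φ(x) = hΦ(x) = Φ(hx)`, so `hx = q^j x`, and `hx = x` by orbit finiteness (`MultTowerNS2.smul_eq_self_of_smul_eq_zpow_mul`).
[cite: GreenbergLNM1716, §3 (pp. 90–92)] [cite: SilvermanATAEC1994, Thm. V.3.1 (c),(d), Thm. V.5.3] -/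
theorem exists_unit_of_mem_fixedPoints (v : HeightOneSpectrum (𝓞 ℚ)) {W : WeierstrassCurve ℚ}
    {Φ : Additive (AlgebraicClosure (v.adicCompletion ℚ))ˣ →+ localPoints W (v.adicCompletion ℚ)}
    {Q : AlgebraicClosure (v.adicCompletion ℚ)} (hsurj : Function.Surjective Φ)
    (hker : ∀ u : (AlgebraicClosure (v.adicCompletion ℚ))ˣ, Φ (Additive.ofMul u) = 0 ↔
      ∃ j : ℤ, (u : AlgebraicClosure (v.adicCompletion ℚ)) = Q ^ j)
    (hequiv : ∀ (σ : absoluteGaloisGroup (v.adicCompletion ℚ)) (u u' : (AlgebraicClosure (v.adicCompletion ℚ))ˣ),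
      (u' : AlgebraicClosure (v.adicCompletion ℚ)) = σ • (u : AlgebraicClosure (v.adicCompletion ℚ)) →
        σ • Φ (Additive.ofMul u) = Φ (Additive.ofMul u'))
    (hQfix : ∀ σ : absoluteGaloisGroup (v.adicCompletion ℚ), σ • Q = Q) (hQ0 : Q ≠ 0)
    (hQtor : ∀ j : ℤ, Q ^ j = 1 → j = 0) (N : Subgroup (absoluteGaloisGroup (v.adicCompletion ℚ)))
    {m : localPoints W (v.adicCompletion ℚ)} (hm : ∀ h ∈ N, h • m = m) :
    ∃ x : (AlgebraicClosure (v.adicCompletion ℚ))ˣ, Φ (Additive.ofMul x) = m ∧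
      ∀ h ∈ N, h • (x : AlgebraicClosure (v.adicCompletion ℚ)) = x := by
  obtain ⟨x', hx'⟩ := hsurj m
  set x : (AlgebraicClosure (v.adicCompletion ℚ))ˣ := Additive.toMul x' with hx
  have hxm : Φ (Additive.ofMul x) = m := by rw [hx, ofMul_toMul]; exact hx'
  refine ⟨x, hxm, fun h hh ↦ ?_⟩
  set u' : (AlgebraicClosure (v.adicCompletion ℚ))ˣ :=
    Units.mk0 (h • (x : AlgebraicClosure (v.adicCompletion ℚ))) ((smul_ne_zero_iff_ne h).mpr x.ne_zero) with hu'
  have h1 := hequiv h x u' rfl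
  rw [hxm, hm h hh, ← hxm, MultTowerNS2.tatePsi_eq_iff v hker] at h1
  obtain ⟨j, hj⟩ := h1
  have hj' : h • (x : AlgebraicClosure (v.adicCompletion ℚ)) = Q ^ (-j) * x := by
    rw [zpow_neg, ← Units.val_mk0 ((smul_ne_zero_iff_ne h).mpr x.ne_zero), ← hu', hj]
    field_simp
  exact MultTowerNS2.smul_eq_self_of_smul_eq_zpow_mul v (hQfix h) hQ0 hQtor x.ne_zero hj'

/-! ### The binder -/

/-- Transport of `HasSplitMultiplicativeReductionAtPrime` along an equality of primes (the `Fact` instances are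
propositionally irrelevant). [folklore] -/
private theorem hasSplitMultiplicativeReductionAtPrime_congr (W : WeierstrassCurve ℚ) {q q' : ℕ} (h : q = q')
    [Fact q.Prime] [Fact q'.Prime] :
    W.HasSplitMultiplicativeReductionAtPrime q ↔ W.HasSplitMultiplicativeReductionAtPrime q' := by
  subst h; exact Iff.rfl

/-- **«One bit at a split multiplicative prime» — KERNEL PROOF of the PRINT binder `hSP1` (Greenberg, LNM 1716, §3,
pp. 91–92: at a SPLIT `v ∣ p`, `ker(r_{v_n})` is a subgroup of `ker(d_{v_n}) ≅ ℚ_p/ℤ_p`, so its `p`-torsion has at most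
`p` elements).** For a globally minimal `W/ℚ` with split multiplicative reduction at the prime `p`, every cyclotomic
`ℤ_p`-datum `κ`, the place `v ∋ p` and every layer `n`, the `p`-torsion of the local tower kernel `𝒦_{v,n}[p^∞]` is
finite of order at most `p`. Proof: BRICK 11 embeds it into the `p`-torsion of `M_∞/(g−1)M_∞`; Tate's split
uniformisation identifies `M_∞` with `Φ(L_∞ˣ)` (`exists_unit_of_mem_fixedPoints`); a `p`-torsion class `[Φ x]` has
`x^p = q^j gz/z`, and two classes with the same `j mod p` coincide by the orbit-product computation
`N_{R+1}((x/x')q^c) = 1` at a finite level and the cyclic Hilbert 90 one layer up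
(`MultTowerSP1.exists_eq_smul_div_of_prod_smul_eq_one`); pigeonhole over `p + 1` classes.
[cite: GreenbergLNM1716, §3, between Prop. 3.6 and Prop. 3.7 (PDF pp. 91–92)]
[cite: SilvermanATAEC1994, Thm. V.3.1 (c),(d), Thm. V.5.3] [cite: NeukirchANT1999, Ch. IV (3.5)] -/
theorem sec3_natCard_pTorsion_localTowerKerPrimary_le_splitMultiplicative_rat_holds :
    Greenberg1999.sec3_natCard_pTorsion_localTowerKerPrimary_le_splitMultiplicative_rat := by
  intro W _ _ p _ hsplit κ hκ v hv n
  -- the groups `H_∞ ≤ H_m`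
  have hile : ∀ m : ℕ, localSubgroup κ.kerSubgroup (v.adicCompletion ℚ) ≤
      localSubgroup (κ.layerSubgroup m) (v.adicCompletion ℚ) := fun m ↦ localSubgroup_ker_le_layer κ _ m
  -- S0: split multiplicative reduction at the place `v`
  haveI hfact : Fact (Nat.Prime (primesEquiv v : ℕ)) := ⟨(primesEquiv v).2⟩
  have hpv : ((primesEquiv v : Nat.Primes) : ℕ) = p := primesEquiv_eq_of_natCast_mem v Fact.out hv
  have hsplitv : W.HasSplitMultiplicativeReductionAt v :=
    (hasSplitMultiplicativeReductionAtPrime_iff_hasSplitMultiplicativeReductionAt W v).mp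
      ((hasSplitMultiplicativeReductionAtPrime_congr W hpv).mpr hsplit)
  -- Tate's split uniformisation at `v`
  obtain ⟨q, Φ, hq0, hqv, hsurj, hker, hequiv, -⟩ :=
    TateCurve.Silverman1994_thmV53_tateUniformisation_holds W v hsplitv
  set Q : AlgebraicClosure (v.adicCompletion ℚ) :=
    algebraMap (v.adicCompletion ℚ) (AlgebraicClosure (v.adicCompletion ℚ)) q with hQ
  have hQ0 : Q ≠ 0 := by rw [hQ]; exact (map_ne_zero _).mpr hq0
  have hQfix : ∀ σ : absoluteGaloisGroup (v.adicCompletion ℚ), σ • Q = Q := fun σ ↦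
    AlgEquiv.commutes (absoluteGaloisGroup.toAlgEquiv _ σ) q
  have hQtor : ∀ j : ℤ, Q ^ j = 1 → j = 0 := by
    intro j hj
    have hj' : q ^ j = 1 := by
      apply (algebraMap (v.adicCompletion ℚ) (AlgebraicClosure (v.adicCompletion ℚ))).injective
      rw [map_zpow₀, map_one]; exact hj
    have hq1 : ‖q‖ < 1 := Valued.toNormedField.norm_lt_one_iff.mpr hqv
    have hpow : ∀ m : ℕ, q ^ m = 1 → m = 0 := fun m hm ↦ by
      by_contra hm0
      have h1 : ‖q‖ ^ m < 1 := pow_lt_one₀ (norm_nonneg q) hq1 hm0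
      rw [← norm_pow, hm, norm_one] at h1
      exact lt_irrefl _ h1
    cases j with
    | ofNat m =>
      rw [Int.ofNat_eq_natCast, zpow_natCast] at hj'
      rw [Int.ofNat_eq_natCast, hpow m hj']
      rfl
    | negSucc m =>
      rw [zpow_negSucc, inv_eq_one] at hj'
      exact absurd (hpow (m + 1) hj') (Nat.succ_ne_zero m)
  -- equivariance in value form
  have hequiv' : ∀ (σ : absoluteGaloisGroup (v.adicCompletion ℚ)) (w w' : (AlgebraicClosure (v.adicCompletion ℚ))ˣ),
      (w' : AlgebraicClosure (v.adicCompletion ℚ)) = σ • (w : AlgebraicClosure (v.adicCompletion ℚ)) →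
        σ • Φ (Additive.ofMul w) = Φ (Additive.ofMul w') := by
    intro σ w w' h
    have hw' : w' = Units.map (absoluteGaloisGroup.toAlgEquiv (v.adicCompletion ℚ) σ :
        AlgebraicClosure (v.adicCompletion ℚ) →* AlgebraicClosure (v.adicCompletion ℚ)) w := Units.ext h
    rw [hw']
    exact hequiv σ w
  -- a topological generator `g ∈ H_n` of `H_n` modulo `H_∞`, `κ(res g) = p^n · unit`
  obtain ⟨g, hgn, hgen⟩ := ZpExtension.exists_mem_localSubgroup_generate κ (v.adicCompletion ℚ) n
  obtain ⟨ug, hug⟩ := exists_units_kappa_resGal_eq_of_generate hκ v hv n hgn hgen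
  have hgR : ∀ R : ℕ, g ^ p ^ R ∈ localSubgroup (κ.layerSubgroup (n + R)) (v.adicCompletion ℚ) := fun R ↦
    (pow_mem_localSubgroup_layerSubgroup_iff (κ := κ) v n R hug _).mpr dvd_rfl
  -- the coinvariants `M_∞/(g-1)M_∞`
  set P := localPoints W (v.adicCompletion ℚ) with hP
  set M : AddSubgroup P :=
    FixedPoints.addSubgroup (localSubgroup κ.kerSubgroup (v.adicCompletion ℚ)) P with hM
  have memM : ∀ {a : P}, a ∈ M ↔ ∀ h ∈ localSubgroup κ.kerSubgroup (v.adicCompletion ℚ), h • a = a := fun {a} ↦ by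
    rw [hM, FixedPoints.mem_addSubgroup]
    exact ⟨fun H h hh ↦ H ⟨h, hh⟩, fun H h ↦ H h h.2⟩
  set d : M →+ M := subOne (localSubgroup κ.kerSubgroup (v.adicCompletion ℚ)) P g with hd
  -- `Φ` of an `H_∞`-fixed unit lies in `M_∞`
  have hΦM : ∀ x : (AlgebraicClosure (v.adicCompletion ℚ))ˣ,
      (∀ h ∈ localSubgroup κ.kerSubgroup (v.adicCompletion ℚ), h • (x : AlgebraicClosure (v.adicCompletion ℚ)) = x) →
        Φ (Additive.ofMul x) ∈ M := fun x hx ↦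
    memM.mpr fun h hh ↦ hequiv' h x x (hx h hh).symm
  -- every `p`-torsion class has a representative `Φ x`, `x ∈ L_∞ˣ`, with `x^p = Q^j · gz/z`, `z ∈ L_∞ˣ`
  have hrep : ∀ y : {y : M ⧸ d.range // p • y = 0},
      ∃ (x z : (AlgebraicClosure (v.adicCompletion ℚ))ˣ) (j : ℤ) (m : M),
        (m : M ⧸ d.range) = y.1 ∧ (m : P) = Φ (Additive.ofMul x) ∧
        (∀ h ∈ localSubgroup κ.kerSubgroup (v.adicCompletion ℚ),
          h • (x : AlgebraicClosure (v.adicCompletion ℚ)) = x) ∧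
        (∀ h ∈ localSubgroup κ.kerSubgroup (v.adicCompletion ℚ),
          h • (z : AlgebraicClosure (v.adicCompletion ℚ)) = z) ∧
        (x : AlgebraicClosure (v.adicCompletion ℚ)) ^ p =
          Q ^ j * (g • (z : AlgebraicClosure (v.adicCompletion ℚ)) / z) := by
    rintro ⟨y, hy⟩
    obtain ⟨m, rfl⟩ := QuotientAddGroup.mk_surjective y
    obtain ⟨x, hxm, hxL⟩ := exists_unit_of_mem_fixedPoints v hsurj hker hequiv' hQfix hQ0 hQtor _ (memM.mp m.2)
    -- `p m ∈ (g-1) M_∞`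
    have hpm : (p • m : M) ∈ d.range := by
      rw [← QuotientAddGroup.eq_zero_iff]
      exact hy
    obtain ⟨w, hw⟩ := hpm
    obtain ⟨z, hzm, hzL⟩ := exists_unit_of_mem_fixedPoints v hsurj hker hequiv' hQfix hQ0 hQtor _ (memM.mp w.2)
    -- `Φ (x^p) = Φ (gz / z)`
    set gz : (AlgebraicClosure (v.adicCompletion ℚ))ˣ :=
      Units.mk0 (g • (z : AlgebraicClosure (v.adicCompletion ℚ))) ((smul_ne_zero_iff_ne g).mpr z.ne_zero) with hgz
    have hgΦ : g • Φ (Additive.ofMul z) = Φ (Additive.ofMul gz) := hequiv' g z gz rfl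
    have h3 : Φ (Additive.ofMul (x ^ p)) = Φ (Additive.ofMul (gz * z⁻¹)) := by
      rw [ofMul_pow, map_nsmul, hxm, ofMul_mul, ofMul_inv, map_add, map_neg, ← hgΦ, hzm, ← sub_eq_add_neg]
      have h4 := congrArg (fun b : M ↦ (b : P)) hw
      simp only [hd, AddSubgroupClass.coe_nsmul] at h4
      exact h4.symm
    rw [MultTowerNS2.tatePsi_eq_iff v hker] at h3
    obtain ⟨j, hj⟩ := h3
    refine ⟨x, z, j, m, rfl, hxm.symm, hxL, hzL, ?_⟩
    rw [Units.val_pow_eq_pow_val] at hj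
    rw [hj, Units.val_mul, Units.val_inv_eq_inv_val, hgz, Units.val_mk0, div_eq_mul_inv]
  choose x z j m hmy hmx hxL hzL hxp using hrep
  -- among `p + 1` `p`-torsion classes two coincide
  have keyp : ∀ ys : Fin (p + 1) → {y : M ⧸ d.range // p • y = 0}, ∃ i i' : Fin (p + 1), i ≠ i' ∧ ys i = ys i' := by
    intro ys
    -- pigeonhole on `j mod p`
    obtain ⟨i, i', hii', hjj⟩ := Fintype.exists_ne_map_eq_of_card_lt
      (fun i : Fin (p + 1) ↦ ((j (ys i) : ℤ) : ZMod p)) (by rw [ZMod.card, Fintype.card_fin]; omega)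
    refine ⟨i, i', hii', ?_⟩
    obtain ⟨c, hc⟩ := (ZMod.intCast_eq_intCast_iff_dvd_sub _ _ _).mp hjj
    -- `σ (a / b) = σ a / σ b` on `K̄_v`
    have hsdiv : ∀ (σ : absoluteGaloisGroup (v.adicCompletion ℚ)) (a b : AlgebraicClosure (v.adicCompletion ℚ)),
        σ • (a / b) = σ • a / σ • b := fun σ a b ↦ by
      rw [div_eq_mul_inv, smul_mul', smul_inv'', div_eq_mul_inv]
    have hx0 : ∀ k, (x (ys k) : AlgebraicClosure (v.adicCompletion ℚ)) ≠ 0 := fun k ↦ (x (ys k)).ne_zero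
    have hz0 : ∀ k, (z (ys k) : AlgebraicClosure (v.adicCompletion ℚ)) ≠ 0 := fun k ↦ (z (ys k)).ne_zero
    -- `y = (x_i / x_i') Q^c` and `ζ = z_i / z_i'`, with `y^p = gζ/ζ`
    set yy : AlgebraicClosure (v.adicCompletion ℚ) :=
      (x (ys i) : AlgebraicClosure (v.adicCompletion ℚ)) / (x (ys i')) * Q ^ c with hyy
    set ζ : AlgebraicClosure (v.adicCompletion ℚ) :=
      (z (ys i) : AlgebraicClosure (v.adicCompletion ℚ)) / (z (ys i')) with hζ
    have hζ0 : ζ ≠ 0 := div_ne_zero (hz0 i) (hz0 i')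
    have hyL : ∀ h ∈ localSubgroup κ.kerSubgroup (v.adicCompletion ℚ), h • yy = yy := fun h hh ↦ by
      rw [hyy, smul_mul', hsdiv, smul_zpow₀', hxL _ h hh, hxL _ h hh, hQfix]
    have hζL : ∀ h ∈ localSubgroup κ.kerSubgroup (v.adicCompletion ℚ), h • ζ = ζ := fun h hh ↦ by
      rw [hζ, hsdiv, hzL _ h hh, hzL _ h hh]
    have hyp : yy ^ p = g • ζ / ζ := by
      have e1 := hxp (ys i)
      have e2 := hxp (ys i')
      have hgz0 : g • (z (ys i') : AlgebraicClosure (v.adicCompletion ℚ)) ≠ 0 :=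
        (smul_ne_zero_iff_ne g).mpr (hz0 i')
      rw [hyy, hζ, mul_pow, div_pow, e1, e2, hsdiv, ← zpow_natCast (Q ^ c) p, ← zpow_mul,
        show j (ys i') = j (ys i) + (p : ℤ) * c by linear_combination hc]
      rw [zpow_add₀ hQ0, mul_comm (p : ℤ) c]
      field_simp
    -- a finite level `F_{n+R} ∋ y, ζ`
    obtain ⟨my, hmy'⟩ := exists_forall_mem_localSubgroup_layerSubgroup_smul_eq (κ := κ) v yy hyL
    obtain ⟨mz, hmz'⟩ := exists_forall_mem_localSubgroup_layerSubgroup_smul_eq (κ := κ) v ζ hζL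
    set R : ℕ := my + mz with hR
    have hyR : ∀ h ∈ localSubgroup (κ.layerSubgroup (n + R)) (v.adicCompletion ℚ), h • yy = yy := fun h hh ↦
      hmy' h (localSubgroup_layerSubgroup_antitone κ (v.adicCompletion ℚ) (by omega) hh)
    have hζR : ∀ h ∈ localSubgroup (κ.layerSubgroup (n + R)) (v.adicCompletion ℚ), h • ζ = ζ := fun h hh ↦
      hmz' h (localSubgroup_layerSubgroup_antitone κ (v.adicCompletion ℚ) (by omega) hh)
    have hgRy : (g ^ p ^ R) • yy = yy := hyR _ (hgR R)
    have hgRζ : (g ^ p ^ R) • ζ = ζ := hζR _ (hgR R)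
    -- orbit products: `N_R(y)^p = 1`, hence `N_{R+1}(y) = 1`
    have hNζ0 : (∏ k ∈ Finset.range (p ^ R), (g ^ k) • ζ) ≠ 0 :=
      Finset.prod_ne_zero_iff.mpr fun k _ ↦ (smul_ne_zero_iff_ne _).mpr hζ0
    have hNp : (∏ k ∈ Finset.range (p ^ R), (g ^ k) • yy) ^ p = 1 := by
      rw [← prod_smul_pow, hyp, div_eq_mul_inv, MultTowerNS2.prod_smul_mul, MultTowerNS2.prod_smul_inv,
        MultTowerNS2.prod_smul_smul_eq g (p ^ R) hgRζ, mul_inv_cancel₀ hNζ0]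
    have hN1 : (∏ k ∈ Finset.range (p ^ (R + 1)), (g ^ k) • yy) = 1 := by
      rw [pow_succ, prod_smul_range_mul_eq_pow g (p ^ R) hgRy p, hNp]
    -- Hilbert 90 one layer up: `y = gw/w`, `w ∈ F_{n+R+1}ˣ`
    have hyR1 : ∀ h ∈ localSubgroup (κ.layerSubgroup (n + (R + 1))) (v.adicCompletion ℚ), h • yy = yy := fun h hh ↦
      hyR h (localSubgroup_layerSubgroup_antitone κ (v.adicCompletion ℚ) (by omega) hh)
    obtain ⟨w, hw0, hwL, hyw⟩ := exists_eq_smul_div_of_prod_smul_eq_one (κ := κ) v n (R + 1) hug hyR1 hN1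
    -- `Φ (x i) - Φ (x i') = (g - 1) Φ(w)` with `Φ w ∈ M_∞`
    set wu : (AlgebraicClosure (v.adicCompletion ℚ))ˣ := Units.mk0 w hw0 with hwu
    have hwM : Φ (Additive.ofMul wu) ∈ M := hΦM wu fun h hh ↦ by
      rw [hwu, Units.val_mk0]; exact hwL h (hile _ hh)
    set gw : (AlgebraicClosure (v.adicCompletion ℚ))ˣ := Units.mk0 (g • w) ((smul_ne_zero_iff_ne g).mpr hw0) with hgw
    have hgΦ : g • Φ (Additive.ofMul wu) = Φ (Additive.ofMul gw) :=
      hequiv' g wu gw (by rw [hgw, hwu, Units.val_mk0, Units.val_mk0])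
    have hdP : (d ⟨Φ (Additive.ofMul wu), hwM⟩ : P) = g • Φ (Additive.ofMul wu) - Φ (Additive.ofMul wu) := rfl
    have hdiff : Φ (Additive.ofMul (x (ys i))) - Φ (Additive.ofMul (x (ys i'))) =
        (d ⟨Φ (Additive.ofMul wu), hwM⟩ : P) := by
      rw [hdP, hgΦ]
      have e1 : Φ (Additive.ofMul (x (ys i))) - Φ (Additive.ofMul (x (ys i'))) =
          Φ (Additive.ofMul (x (ys i) * (x (ys i'))⁻¹)) := by
        rw [ofMul_mul, ofMul_inv, map_add, map_neg, sub_eq_add_neg]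
      have e2 : Φ (Additive.ofMul gw) - Φ (Additive.ofMul wu) = Φ (Additive.ofMul (gw * wu⁻¹)) := by
        rw [ofMul_mul, ofMul_inv, map_add, map_neg, sub_eq_add_neg]
      rw [e1, e2, MultTowerNS2.tatePsi_eq_iff v hker]
      refine ⟨-c, ?_⟩
      rw [Units.val_mul, Units.val_inv_eq_inv_val, Units.val_mul, Units.val_inv_eq_inv_val, hgw, hwu, Units.val_mk0,
        Units.val_mk0, ← div_eq_mul_inv, ← div_eq_mul_inv, ← hyw, hyy, zpow_neg]
      field_simp
    have hmm : (m (ys i) : M ⧸ d.range) = m (ys i') := by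
      rw [QuotientAddGroup.eq_iff_sub_mem]
      refine ⟨⟨Φ (Additive.ofMul wu), hwM⟩, Subtype.ext ?_⟩
      rw [AddSubgroupClass.coe_sub, hmx, hmx]
      exact hdiff.symm
    exact Subtype.ext (by rw [← hmy (ys i), ← hmy (ys i'), hmm])
  -- hence the `p`-torsion of the coinvariants is finite of order `≤ p`
  haveI hfin : Finite {y : M ⧸ d.range // p • y = 0} := by
    by_contra hinf
    rw [not_finite_iff_infinite] at hinf
    let emb := Infinite.natEmbedding {y : M ⧸ d.range // p • y = 0}
    obtain ⟨i, i', hii', h⟩ := keyp (fun i : Fin (p + 1) ↦ emb i)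
    exact hii' (Fin.ext (emb.injective h))
  have hcard : Nat.card {y : M ⧸ d.range // p • y = 0} ≤ p := by
    by_contra hlt
    push Not at hlt
    letI := Fintype.ofFinite {y : M ⧸ d.range // p • y = 0}
    rw [Nat.card_eq_fintype_card] at hlt
    let emb : Fin (p + 1) ↪ {y : M ⧸ d.range // p • y = 0} :=
      (Fin.castLEEmb hlt).trans (Fintype.equivFin _).symm.toEmbedding
    obtain ⟨i, i', hii', h⟩ := keyp emb
    exact hii' (emb.injective h)
  -- BRICK 11
  have h11 := MultTowerNS2.finite_torsionBy_localTowerKerPrimary_and_card_le W κ (v.adicCompletion ℚ) n hgn hgen p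
  exact ⟨h11.1, h11.2.trans hcard⟩

end Summit.BirchSwinnertonDyer.BirchSwinnertonDyer.Theorems.MultTowerSP1

end
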